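import Mathlib.RingTheory.AdjoinRoot
import Mathlib.Data.ZMod.Basic
import Mathlib.Data.Nat.Size
import HarnessLib

/-!
# Cyclic list arithmetic: `ℤ_n[X]/(X^r - 1)` on coefficient lists (the arithmetic of the AKS test)

Toolkit for the polynomial identity test of the Agrawal–Kayal–Saxena primality algorithm
[AKS04, §4 step 5, §5]: the congruence `(X + a)^n ≡ X^n + a (mod X^r - 1, n)` is decided by
repeated squaring of polynomials of degree `< r` with coefficients reduced modulo `n`. This file is
the LIST-LEVEL MODEL of that computation and its algebraic meaning; the `FP` string bricks that run
it (`CyclicListBricks.lean`, `CyclicPowBricks.lean`) compute literally these lists.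

A residue class modulo `(X^r - 1, n)` is held as the list of its `r` coefficients, HIGHEST DEGREE
FIRST (`[c_{r-1}, …, c_1, c_0]`), each in `[0, n)`:

* `CycList.rot` — multiplication by `X` (move the head to the back);
* `CycList.axpy n a B C` — `a • B + C` coefficientwise modulo `n` (`List.zipWith`);
* `CycList.mul n A B` — the product, by Horner's rule over the coefficients of `A`
  (`acc := X • acc + aᵢ • B`, `i = r - 1, …, 0`), starting from the zero list;
* `CycList.powAux n k e acc base` — `k` rounds of LSB-first square-and-multiply;
* `CycList.one`, `CycList.linear` (`X + a`), `CycList.constP`, `CycList.xpow` (`X^m`),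
  `CycList.lhs r n a` (the list computed for `(X + a)^n`) and `CycList.rhs r n a` (the list of
  `X^(n mod r) + a`);
* `CycList.toPoly`, `CycList.toQ` — the polynomial / the class in
  `AdjoinRoot (X^r - 1 : (ZMod n)[X])` a list denotes; lengths and reducedness of all of the above.

The algebra (`toQ (mul n A B) = toQ A * toQ B`, …, and
`lhs r n a = rhs r n a ↔ X^r - 1 ∣ (X + a)^n - (X^n + a)` over `ZMod n`) is in
`CyclicListArithSpec.lean`.

## Relation to `Literature/NumberTheory/Primality/AKSPolyArith.lean`

The tree already holds a list-level model of the same ring arithmetic,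
`Literature.NumberTheory.Primality.AKS.cmul/cone/cpowAux/cpow/xPlusA/xnPlusA` with semantics `AKS.sem`
and `AKS.congrTest_eq_true_iff`. That model is LOWEST-degree-first and multiplies by the CONVOLUTION
FORMULA with random access (`List.getD`), which suits a hand-written tape machine. The present model is
a deliberately different SUCCESSOR shaped by the `FP` brick algebra of `Computability/Complexity`
(`ListBricks.lean`: `zipLF`, `zipFoldLF`, `mapLF` process coded lists from the head, with no random
access): HIGHEST-degree-first lists, on which multiplication by `X` is the head-to-back move `rot`
(one `append`), and the product is a HORNER FOLD over the coefficients of one factor (one `zipFoldLF` of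
one `zipLF`), so that `CyclicListBricks.lean` computes `mul` literally and its `FP` membership is by
composition lemmas. The two models denote the same ring: for a list `l` of length `r`,
`toQ r n l = AKS.sem n r l.reverse` (both are `∑ᵢ l.reverse[i] ρⁱ`, `ρ` the class of `X`); we do not
import `AKSPolyArith` (its `PowerBasis`/finite-field imports are not needed here) and re-prove the
25-line injectivity-on-reduced-lists argument for this representation (`eq_of_toPoly_eq`, and
`CycList.lhs_eq_rhs_iff` in the Spec file, the analogue of `AKS.congrTest_eq_true_iff`). Once the
`FP` machine of the AKS test is assembled from these bricks, `AKSPolyArith.lean` (which has no importers)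
can be retired by the librarian or kept as the random-access variant.

## References

* [AKS04] M. Agrawal, N. Kayal, N. Saxena, *PRIMES is in P*, Ann. of Math. 160 (2004) 781–793,
  §4 (the algorithm, step 5) and §5 (Thm 5.1: each congruence costs `O~(r log² n)` by repeated
  squaring on `r` coefficients of `O(log n)` bits).
* D. E. Knuth, *The Art of Computer Programming*, Vol. 2, 3rd ed., 1998, §4.6.3 (binary method
  for powers), §4.6.1 (arithmetic of polynomials modulo a polynomial).
-/

namespace Literature.Computability.Complexity

open Polynomial

namespace CycList

/-! ### The list operations -/

/-- Multiplication by `X` modulo `X^r - 1` on a highest-degree-first coefficient list: the leading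
coefficient (of `X^{r-1}`) becomes the constant coefficient (the head-to-back move; contrast the
random-access `AKS.cmul` of `AKSPolyArith.lean`). [cite: AgrawalKayalSaxena2004, §5] -/
def rot : List ℕ → List ℕ
  | [] => []
  | h :: t => t ++ [h]

/-- `a • B + C` coefficientwise modulo `n`. [cite: KnuthTAOCP2, §4.6.1] -/
def axpy (n a : ℕ) (B C : List ℕ) : List ℕ := List.zipWith (fun b c => (a * b + c) % n) B C

/-- The product modulo `(X^r - 1, n)` by Horner's rule over the coefficients of `A` (highest first):
`acc := X • acc + aᵢ • B`, from the zero list of the length of `A` (a left fold, realised by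
`Brick.zipFoldLF`; it denotes the same product as the convolution `AKS.cmul` of `AKSPolyArith.lean` on
reversed lists). [cite: KnuthTAOCP2, §4.6.1] -/
def mul (n : ℕ) (A B : List ℕ) : List ℕ :=
  A.foldl (fun acc a => axpy n a B (rot acc)) (List.replicate A.length 0)

/-- `k` rounds of LSB-first square-and-multiply: `(e, acc, base) ↦ (e / 2, acc · base^{e mod 2}, base²)`.
[cite: KnuthTAOCP2, §4.6.3 (Algorithm A)] -/
def powAux (n : ℕ) : ℕ → ℕ → List ℕ → List ℕ → List ℕ
  | 0, _, acc, _ => acc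
  | k + 1, e, acc, base => powAux n k (e / 2) (if e % 2 = 1 then mul n acc base else acc) (mul n base base)

/-- The zero class with `r` coefficients. [folklore] -/
def zero (r : ℕ) : List ℕ := List.replicate r 0

/-- The class of `1` with `r ≥ 1` coefficients. [folklore] -/
def one (r : ℕ) : List ℕ := List.replicate (r - 1) 0 ++ [1]

/-- The class of the constant `a mod n` with `r ≥ 1` coefficients. [folklore] -/
def constP (r n a : ℕ) : List ℕ := List.replicate (r - 1) 0 ++ [a % n]

/-- The class of `X + a` with `r ≥ 2` coefficients. [cite: AgrawalKayalSaxena2004, §4 (step 5)] -/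
def linear (r n a : ℕ) : List ℕ := List.replicate (r - 2) 0 ++ [1, a % n]

/-- The class of `X^m`: `m` rotations of `one r`. [folklore] -/
def xpow (r m : ℕ) : List ℕ := rot^[m] (one r)

/-- The list computed for `(X + a)^n`: `Nat.size n` rounds of square-and-multiply from `1`.
[cite: AgrawalKayalSaxena2004, §5 (proof of Thm 5.1)] -/
def lhs (r n a : ℕ) : List ℕ := powAux n (Nat.size n) n (one r) (linear r n a)

/-- The list of `X^(n mod r) + a`, the right-hand side of the AKS congruence reduced modulo `X^r - 1`.
[cite: AgrawalKayalSaxena2004, §4 (step 5)] -/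
def rhs (r n a : ℕ) : List ℕ := axpy n 1 (xpow r (n % r)) (constP r n a)

/-- All entries are reduced modulo `n`. [folklore] -/
def Reduced (n : ℕ) (l : List ℕ) : Prop := ∀ v ∈ l, v < n

/-! ### Lengths -/

/-- `rot` keeps the length. [folklore] -/
@[simp] theorem length_rot (l : List ℕ) : (rot l).length = l.length := by
  cases l <;> simp [rot]

/-- Iterated `rot` keeps the length. [folklore] -/
@[simp] theorem length_rot_iterate (m : ℕ) (l : List ℕ) : (rot^[m] l).length = l.length := by
  induction m generalizing l with
  | zero => rfl
  | succ m ih => rw [Function.iterate_succ_apply, ih, length_rot]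

/-- Length of `axpy`. [folklore] -/
@[simp] theorem length_axpy (n a : ℕ) (B C : List ℕ) : (axpy n a B C).length = min B.length C.length := by
  simp [axpy]

/-- The Horner fold keeps an accumulator of the length of `B`. [folklore] -/
theorem length_foldl_axpy (n : ℕ) (B : List ℕ) : ∀ (A acc : List ℕ), acc.length = B.length →
    (A.foldl (fun acc a => axpy n a B (rot acc)) acc).length = B.length
  | [], acc, h => h
  | a :: A, acc, h => by
    rw [List.foldl_cons]
    exact length_foldl_axpy n B A _ (by simp [h])

/-- Length of a product of two lists of the same length. [folklore] -/
@[simp] theorem length_mul (n : ℕ) {A B : List ℕ} (h : A.length = B.length) : (mul n A B).length = B.length :=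
  length_foldl_axpy n B A _ (by simp [h])

/-- Length after square-and-multiply rounds. [folklore] -/
@[simp] theorem length_powAux (n r : ℕ) : ∀ (k e : ℕ) (acc base : List ℕ), acc.length = r → base.length = r →
    (powAux n k e acc base).length = r
  | 0, e, acc, base, ha, _ => ha
  | k + 1, e, acc, base, ha, hb => by
    rw [powAux]
    refine length_powAux n r k _ _ _ ?_ (by rw [length_mul n rfl, hb])
    split_ifs
    · rw [length_mul n (ha.trans hb.symm), hb]
    · exact ha

/-- Length of `zero r`. [folklore] -/
@[simp] theorem length_zero (r : ℕ) : (zero r).length = r := by simp [zero]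

/-- Length of `one r` (`r ≥ 1`). [folklore] -/
@[simp] theorem length_one {r : ℕ} (hr : 1 ≤ r) : (one r).length = r := by
  simp [one]; omega

/-- Length of `constP r n a` (`r ≥ 1`). [folklore] -/
@[simp] theorem length_constP {r : ℕ} (hr : 1 ≤ r) (n a : ℕ) : (constP r n a).length = r := by
  simp [constP]; omega

/-- Length of `linear r n a` (`r ≥ 2`). [folklore] -/
@[simp] theorem length_linear {r : ℕ} (hr : 2 ≤ r) (n a : ℕ) : (linear r n a).length = r := by
  simp [linear]; omega

/-- Length of `xpow r m` (`r ≥ 1`). [folklore] -/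
@[simp] theorem length_xpow {r : ℕ} (hr : 1 ≤ r) (m : ℕ) : (xpow r m).length = r := by
  simp [xpow, length_one hr]

/-- Length of `lhs r n a` (`r ≥ 2`). [folklore] -/
@[simp] theorem length_lhs {r : ℕ} (hr : 2 ≤ r) (n a : ℕ) : (lhs r n a).length = r :=
  length_powAux n r _ _ _ _ (length_one (by omega)) (length_linear hr n a)

/-- Length of `rhs r n a` (`r ≥ 1`). [folklore] -/
@[simp] theorem length_rhs {r : ℕ} (hr : 1 ≤ r) (n a : ℕ) : (rhs r n a).length = r := by
  simp [rhs, length_xpow hr, length_constP hr]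

/-! ### Reducedness -/

/-- `axpy` outputs are reduced (`n ≥ 1`). [folklore] -/
theorem reduced_axpy {n : ℕ} (hn : 1 ≤ n) (a : ℕ) : ∀ (B C : List ℕ), Reduced n (axpy n a B C)
  | [], C => by simp [axpy, Reduced]
  | b :: B, [] => by simp [axpy, Reduced]
  | b :: B, c :: C => by
    intro v hv
    simp only [axpy, List.zipWith_cons_cons, List.mem_cons] at hv
    rcases hv with rfl | hv
    · exact Nat.mod_lt _ hn
    · exact reduced_axpy hn a B C v hv

/-- `rot` keeps reducedness. [folklore] -/
theorem Reduced.rot {n : ℕ} {l : List ℕ} (h : Reduced n l) : Reduced n (rot l) := by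
  cases l with
  | nil => exact h
  | cons a t => intro v hv; simp [CycList.rot] at hv; exact h v (by simp; tauto)

/-- A Horner fold from a reduced accumulator is reduced (`n ≥ 1`). [folklore] -/
theorem reduced_foldl_axpy {n : ℕ} (hn : 1 ≤ n) (B : List ℕ) : ∀ (A acc : List ℕ), Reduced n acc →
    Reduced n (A.foldl (fun acc a => axpy n a B (rot acc)) acc)
  | [], acc, h => h
  | a :: A, acc, _ => by
    rw [List.foldl_cons]
    exact reduced_foldl_axpy hn B A _ (reduced_axpy hn a B _)

/-- `zero r` is reduced (`n ≥ 1`). [folklore] -/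
theorem reduced_zero {n : ℕ} (hn : 1 ≤ n) (r : ℕ) : Reduced n (zero r) := by
  intro v hv; simp [zero] at hv; omega

/-- Products are reduced (`n ≥ 1`). [folklore] -/
theorem reduced_mul {n : ℕ} (hn : 1 ≤ n) (A B : List ℕ) : Reduced n (mul n A B) :=
  reduced_foldl_axpy hn B A _ (reduced_zero hn _)

/-- Square-and-multiply keeps the accumulator reduced (`n ≥ 1`). [folklore] -/
theorem reduced_powAux {n : ℕ} (hn : 1 ≤ n) : ∀ (k e : ℕ) (acc base : List ℕ), Reduced n acc →
    Reduced n (powAux n k e acc base)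
  | 0, e, acc, base, h => h
  | k + 1, e, acc, base, h => by
    rw [powAux]
    refine reduced_powAux hn k _ _ _ ?_
    split_ifs
    · exact reduced_mul hn _ _
    · exact h

/-- `one r` is reduced (`n ≥ 2`). [folklore] -/
theorem reduced_one {n : ℕ} (hn : 2 ≤ n) (r : ℕ) : Reduced n (one r) := by
  intro v hv; simp [one] at hv; omega

/-- `constP r n a` is reduced (`n ≥ 1`). [folklore] -/
theorem reduced_constP {n : ℕ} (hn : 1 ≤ n) (r a : ℕ) : Reduced n (constP r n a) := by
  intro v hv
  simp [constP] at hv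
  rcases hv with ⟨-, rfl⟩ | rfl
  · omega
  · exact Nat.mod_lt _ hn

/-- `linear r n a` is reduced (`n ≥ 2`). [folklore] -/
theorem reduced_linear {n : ℕ} (hn : 2 ≤ n) (r a : ℕ) : Reduced n (linear r n a) := by
  intro v hv
  simp [linear] at hv
  rcases hv with ⟨-, rfl⟩ | rfl | rfl
  · omega
  · omega
  · exact Nat.mod_lt _ (by omega)

/-- `lhs r n a` is reduced (`n ≥ 2`). [folklore] -/
theorem reduced_lhs {n : ℕ} (hn : 2 ≤ n) (r a : ℕ) : Reduced n (lhs r n a) :=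
  reduced_powAux (by omega) _ _ _ _ (reduced_one hn r)

/-- `rhs r n a` is reduced (`n ≥ 1`). [folklore] -/
theorem reduced_rhs {n : ℕ} (hn : 1 ≤ n) (r a : ℕ) : Reduced n (rhs r n a) :=
  reduced_axpy hn _ _ _

/-! ### The polynomial denoted by a list -/

/-- The polynomial over `ZMod n` denoted by a highest-degree-first coefficient list:
`toPoly [c_{k-1}, …, c_0] = Σ cᵢ Xⁱ`. [folklore] -/
noncomputable def toPoly (n : ℕ) : List ℕ → (ZMod n)[X]
  | [] => 0
  | h :: t => C (h : ZMod n) * X ^ t.length + toPoly n t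

/-- The class modulo `X^r - 1` denoted by a list (for `|l| = r` this is `AKS.sem n r l.reverse` of
`AKSPolyArith.lean`). [cite: AgrawalKayalSaxena2004, §4 (step 5)] -/
noncomputable def toQ (r n : ℕ) (l : List ℕ) : AdjoinRoot (X ^ r - 1 : (ZMod n)[X]) :=
  AdjoinRoot.mk _ (toPoly n l)

/-- `toPoly` of `nil`. [folklore] -/
@[simp] theorem toPoly_nil (n : ℕ) : toPoly n [] = 0 := rfl

/-- `toPoly` of a `cons`. [folklore] -/
@[simp] theorem toPoly_cons (n h : ℕ) (t : List ℕ) : toPoly n (h :: t) = C (h : ZMod n) * X ^ t.length + toPoly n t := rfl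

/-- `toPoly` of an append: the front part is shifted by the length of the back part. [folklore] -/
theorem toPoly_append (n : ℕ) : ∀ (l₁ l₂ : List ℕ), toPoly n (l₁ ++ l₂) = toPoly n l₁ * X ^ l₂.length + toPoly n l₂
  | [], l₂ => by simp
  | h :: t, l₂ => by
    rw [List.cons_append, toPoly_cons, toPoly_append n t l₂, toPoly_cons, List.length_append, pow_add]
    ring

/-- Appending one coefficient: `toPoly (l ++ [c]) = toPoly l * X + c`. [folklore] -/
theorem toPoly_append_singleton (n : ℕ) (l : List ℕ) (c : ℕ) : toPoly n (l ++ [c]) = toPoly n l * X + C (c : ZMod n) := by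
  rw [toPoly_append]; simp

/-- Leading zeros do not matter. [folklore] -/
@[simp] theorem toPoly_replicate_zero_append (n k : ℕ) (l : List ℕ) : toPoly n (List.replicate k 0 ++ l) = toPoly n l := by
  induction k with
  | zero => rfl
  | succ k ih => rw [List.replicate_succ, List.cons_append, toPoly_cons]; simp [ih]

/-- The zero list denotes `0`. [folklore] -/
@[simp] theorem toPoly_zero (n r : ℕ) : toPoly n (zero r) = 0 := by
  simpa [zero] using toPoly_replicate_zero_append n r []

/-- `one r` denotes `1`. [folklore] -/
@[simp] theorem toPoly_one (n r : ℕ) : toPoly n (one r) = 1 := by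
  simp [one]

/-- `constP r n a` denotes the constant `a`. [folklore] -/
@[simp] theorem toPoly_constP (r n a : ℕ) : toPoly n (constP r n a) = C (a : ZMod n) := by
  simp [constP]

/-- `linear r n a` denotes `X + a`. [folklore] -/
@[simp] theorem toPoly_linear (r n a : ℕ) : toPoly n (linear r n a) = X + C (a : ZMod n) := by
  simp [linear]

/-- The degree of the denoted polynomial is less than the length of the list. [folklore] -/
theorem degree_toPoly_lt (n : ℕ) : ∀ l : List ℕ, (toPoly n l).degree < l.length
  | [] => by simp
  | h :: t => by
    rw [toPoly_cons, List.length_cons]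
    refine (degree_add_le _ _).trans_lt (max_lt ?_ ?_)
    · refine (degree_C_mul_X_pow_le _ _).trans_lt ?_
      exact_mod_cast Nat.lt_succ_self _
    · refine (degree_toPoly_lt n t).trans ?_
      exact_mod_cast Nat.lt_succ_self _

/-- The coefficients of the denoted polynomial, read from the back of the list:
`coeff (toPoly l) i = l.reverse[i]` for `i < |l|`, and `0` beyond. [folklore] -/
theorem coeff_toPoly (n : ℕ) (l : List ℕ) (i : ℕ) :
    (toPoly n l).coeff i = if h : i < l.length then ((l.reverse[i]'(by simpa using h) : ℕ) : ZMod n) else 0 := by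
  induction l using List.reverseRecOn generalizing i with
  | nil => simp
  | append_singleton l c ih =>
    rw [toPoly_append_singleton]
    simp only [List.length_append, List.length_singleton, List.reverse_append, List.reverse_singleton,
      List.singleton_append]
    cases i with
    | zero => simp
    | succ i =>
      rw [coeff_add, coeff_mul_X, coeff_C_succ, add_zero, ih]
      by_cases hi : i < l.length
      · rw [dif_pos hi, dif_pos (by omega)]
        simp
      · rw [dif_neg hi, dif_neg (by omega)]

/-- **Reduced lists of equal length denoting the same polynomial are equal.** [folklore] -/
theorem eq_of_toPoly_eq {n : ℕ} {l₁ l₂ : List ℕ} (h₁ : Reduced n l₁) (h₂ : Reduced n l₂)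
    (hlen : l₁.length = l₂.length) (h : toPoly n l₁ = toPoly n l₂) : l₁ = l₂ := by
  rw [← List.reverse_inj]
  refine List.ext_getElem (by simpa using hlen) fun i hi₁ hi₂ => ?_
  have hc := congrArg (fun p => p.coeff i) h
  simp only [coeff_toPoly] at hc
  rw [List.length_reverse] at hi₁ hi₂
  rw [dif_pos hi₁, dif_pos hi₂, ZMod.natCast_eq_natCast_iff',
    Nat.mod_eq_of_lt (h₁ _ (List.mem_reverse.1 (List.getElem_mem _))),
    Nat.mod_eq_of_lt (h₂ _ (List.mem_reverse.1 (List.getElem_mem _)))] at hc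
  exact hc

end CycList

end Literature.Computability.Complexity
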